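import Summits.QuantumFields.YangMills.Theorems.QuantileBitRingTracePeeling
import Summits.QuantumFields.YangMills.Theorems.SwapTwistDeficitEigenData
import HarnessLib

/-!
# Two-insertion zero-flux ring traces of arbitrary period along given eigen-data:
# `Tr_phys(M_O T^m M_O T^{n+1-m}) = Σ λ_k^{n+1-m} λ_l^m ⟨e_l, O e_k⟩²`

Support module for the door `QuantileBitPurity.QuantileBitDoor` (item stmt-QuantumFields-23925, LINE g12-B of seat ym-idea-4).  The
ring-length-general copy of `eigenData_insTrace` (`SwapTwistDeficitEigenDataTraces`): RELATIVE TO GIVEN EIGEN-DATA (`exists_eigenData`: a Hilbert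
basis `b` of `L²(configMeasure)` through the complete physical eigenbasis `e_k`, eigenvalues `lam` of the `L²` operator of `K_β^P`, embedding `emb`),
for `β > 0`, a physical observable `O` with `|O| ≤ C_O`, and `1 ≤ m`, `m + 1 ≤ n`:

  `ringInsTrace L β n O m = Σ_{(k,l) ∈ ℕ × ℕ} λ_k^{n+1-m} λ_l^m (∫ O e_k e_l)²`  (a `HasSum` on `ℕ × ℕ`),

so that the door can read the one-step trace (`m = 1`), the antipodal trace (`m = ⌊L/2⌋`) and the auxiliary indicator traces on the ring of
`L` kernels (`n = L - 1`) along the SAME eigen-sequence.  Proof: the one-bond-insertion form `ringInsTrace_eq_insertOne` fed to Literature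
`hasSum_integral_iterate_insert_one` along `b`; diagonal matrix elements through the honest eigenfunctions (`integral_iterKernelP_mul`,
`eigenData_bilinear`); non-negativity of all terms turns the iterated sum into a double sum.

HONEST FRAMING: fixed-lattice spectral bookkeeping (Reed–Simon I Thm. VI.22–23) for an M-sized support item of a DRAFT line onto a RECORD rung
(K2); no renormalisation-group content; nothing here bears on infinite volume, the continuum limit, a mass gap or Clay.
References: [cite: ReedSimonI1980, Thm. VI.22–VI.23]; [cite: ReedSimonIV1978, Thm. XIII.1]; [cite: MontvayMunster1994, (3.145)].
-/

set_option autoImplicit false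

noncomputable section

open MeasureTheory Filter Topology Function
open Literature.MathematicalPhysics.QuantumFieldTheory
open Literature.MathematicalPhysics.QuantumLattice
open Literature.Analysis.OperatorTheory.YMMatrixModel
open Literature.Analysis.OperatorTheory
open scoped InnerProductSpace BigOperators

namespace Summit.QuantumFields.YangMills.Theorems.FemtoTransferGap.TT

open Summit.QuantumFields.YangMills.Theorems.FemtoTransferGap
open Summit.QuantumFields.YangMills.Theorems.FemtoTransferGap.PhysL2

variable {L : ℕ} [NeZero L]

variable {ι : Type} [Countable ι] {b : HilbertBasis ι ℝ (Lp ℝ 2 (configMeasure SU2 L))} {lam : ι → ℝ}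
  {AP : Lp ℝ 2 (configMeasure SU2 L) →L[ℝ] Lp ℝ 2 (configMeasure SU2 L)} {emb : ℕ → ι}
  {e : ℕ → (GaugeConfig 3 L SU2 → ℝ)} {β : ℝ}

set_option maxHeartbeats 800000 in
/-- **The two-insertion ring trace along given eigen-data**: for `β > 0`, a physical `O` with `|O| ≤ C_O`, `1 ≤ m` and `m + 1 ≤ n`,
`ringInsTrace L β n O m = Σ_{(k,l)} λ_k^{n+1-m} λ_l^m (∫ O e_k e_l)²` as a `HasSum` on `ℕ × ℕ` (`Tr_phys(M_O T^m M_O T^{n+1-m})` in the eigenbasis of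
`T = P K_β P`). [cite: ReedSimonI1980, Thm. VI.22–VI.23] [cite: MontvayMunster1994, (3.145)] -/
theorem eigenData_ringInsTrace (hβ : 0 < β)
    (hAP : ∀ φ : Lp ℝ 2 (configMeasure SU2 L),
      (AP φ : GaugeConfig 3 L SU2 → ℝ) =ᵐ[configMeasure SU2 L] fun x => ∫ y, physKernel β x y * φ y ∂configMeasure SU2 L)
    (hsa : IsSelfAdjoint AP) (hbAP : ∀ i, AP (b i) = lam i • b i) (hinj : Function.Injective emb)
    (hoff : ∀ i ∉ Set.range emb, lam i = 0) (hlam : ∀ k, lam (emb k) = levelValue su2Rep L β k)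
    (hbe : ∀ k, ((b (emb k) : Lp ℝ 2 (configMeasure SU2 L)) : GaugeConfig 3 L SU2 → ℝ) =ᵐ[configMeasure SU2 L] e k)
    (he : ∀ k, IsPhys (e k)) {O : GaugeConfig 3 L SU2 → ℝ} (hO : IsPhys O) {CO : ℝ} (hOb : ∀ U, |O U| ≤ CO)
    {n m : ℕ} (hm : 1 ≤ m) (hmn : m + 1 ≤ n) :
    HasSum (fun p : ℕ × ℕ => levelValue su2Rep L β p.1 ^ (n + 1 - m) * levelValue su2Rep L β p.2 ^ m *
        (∫ U, O U * e p.1 U * e p.2 U ∂configMeasure SU2 L) ^ 2) (ringInsTrace L β n O m) := by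
  classical
  have hCO : 0 ≤ CO := (abs_nonneg _).trans (hOb (fun _ => 1))
  obtain ⟨M0, -, hM0⟩ := exists_abs_transferKernel_le (L := L) β
  have hKP := stronglyMeasurable_physKernel (L := L) β
  have hCP : ∀ U V : GaugeConfig 3 L SU2, ‖physKernel β U V‖ ≤ M0 := fun U V => by
    rw [Real.norm_eq_abs]; exact abs_physKernel_le hM0 U V
  have hmn' : m ≤ n := by omega
  -- the honest bounded observables `g_k = O · e_k`
  have hgm : ∀ k, Measurable fun U => O U * e k U := fun k => hO.measurable.mul (he k).measurable
  have hgb : ∀ k, ∃ B, ∀ U, ‖O U * e k U‖ ≤ B := fun k => by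
    obtain ⟨D, hD⟩ := (he k).bounded
    exact ⟨CO * D, fun U => by rw [norm_mul, Real.norm_eq_abs, Real.norm_eq_abs]; exact mul_le_mul (hOb U) (hD U) (abs_nonneg _) hCO⟩
  choose Bg hBg using hgb
  -- the composite bond `X_m`
  obtain ⟨hKit, Bm, hBm⟩ := measurable_bdd_iterKernelP (L := L) β (m - 1)
  set X : GaugeConfig 3 L SU2 → GaugeConfig 3 L SU2 → ℝ := fun x y =>
    O x * ((fun f : GaugeConfig 3 L SU2 → ℝ => fun w => ∫ z, physKernel β w z * f z ∂configMeasure SU2 L)^[m - 1]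
      (fun w => physKernel β w y)) x * O y with hXdef
  have hX : StronglyMeasurable (uncurry X) := by
    have h1 : Measurable (uncurry X) :=
      ((hO.measurable.comp measurable_fst).mul hKit).mul (hO.measurable.comp measurable_snd)
    exact h1.stronglyMeasurable
  have hObn : ∀ U, ‖O U‖ ≤ CO := fun U => by rw [Real.norm_eq_abs]; exact hOb U
  have hCX : ∀ x y, ‖X x y‖ ≤ CO * Bm * CO := fun x y => by
    simp only [hXdef]
    rw [norm_mul, norm_mul]
    have h1 := hBm x y
    exact mul_le_mul (mul_le_mul (hObn x) h1 (norm_nonneg _) hCO) (hObn y) (norm_nonneg _) (mul_nonneg hCO ((norm_nonneg _).trans h1))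
  obtain ⟨Xop, hXop⟩ := exists_kernelOp (μ := configMeasure SU2 L) hX hCX
  -- Literature: the one-bond-insertion spectral sum
  have hmain := hasSum_integral_iterate_insert_one (μ := configMeasure SU2 L) (b := b) hKP hCP (physKernel_symm β) hAP hbAP hX hCX hXop
    (n - m - 1)
  rw [show n - m - 1 + 1 = n - m by omega, ← ringInsTrace_eq_insertOne β hO hm hmn'] at hmain
  -- the diagonal matrix elements through the honest eigenfunctions
  have hdiag : ∀ k, ⟪b (emb k), Xop (b (emb k))⟫_ℝ = ∫ x, (O x * e k x) *
      ((fun f : GaugeConfig 3 L SU2 → ℝ => fun w => ∫ z, physKernel β w z * f z ∂configMeasure SU2 L)^[m] (fun U => O U * e k U)) x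
        ∂configMeasure SU2 L := by
    intro k
    rw [inner_kernelOp_eq_integral hXop]
    refine integral_congr_ae ?_
    filter_upwards [hbe k] with x hx
    rw [hx]
    have hin : ∫ y, X x y * ((b (emb k) : Lp ℝ 2 (configMeasure SU2 L)) : GaugeConfig 3 L SU2 → ℝ) y ∂configMeasure SU2 L =
        ∫ y, X x y * e k y ∂configMeasure SU2 L :=
      integral_congr_ae (by filter_upwards [hbe k] with y hy; rw [hy])
    rw [hin]
    simp only [hXdef]
    have key := integral_iterKernelP_mul (L := L) β (hgm k) (hBg k) (m - 1) x
    rw [show m - 1 + 1 = m by omega] at key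
    rw [← key, ← integral_const_mul, ← integral_const_mul]
    exact integral_congr_ae (ae_of_all _ fun y => by ring)
  -- the inner sums (bilinear spectral expansion)
  have hinner : ∀ k, HasSum (fun l : ℕ => levelValue su2Rep L β l ^ m * (∫ U, O U * e k U * e l U ∂configMeasure SU2 L) ^ 2)
      ⟪b (emb k), Xop (b (emb k))⟫_ℝ := by
    intro k
    rw [hdiag k]
    have h := eigenData_bilinear hAP hsa hbAP hinj hoff hlam hbe (hgm k) (hBg k) (hgm k) (hBg k) hm
    refine h.congr_fun fun l => ?_
    ring
  -- the outer sum over `ℕ`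
  have houter : HasSum (fun k : ℕ => levelValue su2Rep L β k ^ (n + 1 - m) * ⟪b (emb k), Xop (b (emb k))⟫_ℝ) (ringInsTrace L β n O m) := by
    have h0 : ∀ i ∉ Set.range emb, lam i ^ (n - m - 1 + 2) * ⟪b i, Xop (b i)⟫_ℝ = 0 := fun i hi => by
      rw [hoff i hi, zero_pow (by omega), zero_mul]
    have h2 := (Function.Injective.hasSum_iff hinj h0).mpr hmain
    refine h2.congr_fun fun k => ?_
    simp only [Function.comp_apply, hlam k, show n - m - 1 + 2 = n + 1 - m by omega]
  -- iterated sum of non-negative terms ⇒ double sum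
  set F : ℕ × ℕ → ℝ := fun p => levelValue su2Rep L β p.1 ^ (n + 1 - m) * levelValue su2Rep L β p.2 ^ m *
    (∫ U, O U * e p.1 U * e p.2 U ∂configMeasure SU2 L) ^ 2 with hF
  have hF0 : ∀ p, 0 ≤ F p := fun p =>
    mul_nonneg (mul_nonneg (pow_nonneg (levelValue_su2Rep_pos hβ _).le _) (pow_nonneg (levelValue_su2Rep_pos hβ _).le _)) (sq_nonneg _)
  have hfib : ∀ k, HasSum (fun l => F (k, l)) (levelValue su2Rep L β k ^ (n + 1 - m) * ⟪b (emb k), Xop (b (emb k))⟫_ℝ) := fun k => by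
    have h := (hinner k).mul_left (levelValue su2Rep L β k ^ (n + 1 - m))
    refine h.congr_fun fun l => ?_
    simp only [hF]; ring
  have hsumF : Summable F := by
    refine (summable_prod_of_nonneg hF0).mpr ⟨fun k => (hfib k).summable, ?_⟩
    refine houter.summable.congr fun k => ?_
    exact ((hfib k).tsum_eq).symm
  have htot := hsumF.hasSum.prod_fiberwise hfib
  have heq : ∑' p, F p = ringInsTrace L β n O m := htot.unique houter
  rw [← heq]
  exact hsumF.hasSum

end Summit.QuantumFields.YangMills.Theorems.FemtoTransferGap.TT

end
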